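/- Free-seat work of LEAD seat `ym-line-cbag-p1` (prover-ym-line-cbag-p1-g22-0; own crux stmt-QuantumFields-22254 closed), route
`GlueballBandRecursion` (ideator ym-idea-2, LINE 7): the Assembly item (stmt-QuantumFields-27509). -/
import Summits.QuantumFields.YangMills.Theses.GlueballBandRecursion
import Summits.QuantumFields.YangMills.Theorems.BalabanLadderIRColdPurityBridgeSpectral

/-!
# Route `GlueballBandRecursion`, Assembly (stmt-QuantumFields-27509):
`GapStableUnderRefinement → ThermalMultiplicityUpper → OneGlueballBandLower → ColdDoublingRecursionStrongCoupling` — PROVED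

The route's glue, landed as its ASSEMBLY item: real algebra through the tree's two-sided dictionary between the cold
period-doubling defect `δᶜ_β(L) = 1 − Z(L³×2t)/Z(L³×t)²`, `t = ⌊L/4⌋`, and the thermal trace excess `x_t(L)` of the
`L³` transfer matrix (`one_sub_ratio_le_two_mul_traceExcess`: `δᶜ ≤ 2x`; `one_sub_ratio_ge_of_traceExcess`:
`2x/(1+x)² ≤ δᶜ`) and the tree's strong-coupling smallness `traceExcess_le_of_strongCoupling`.  With the finite-volume rate
`q_L = ⨅ₖ x_{k+2}(L)^{1/(k+2)}` and `t = ⌊L/4⌋`, `t' = ⌊L'/4⌋` (`2L ≤ L' ≤ 4L`, so `2t ≤ t' ≤ L`):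

  `δᶜ(L') ≤ 2x_{t'}(L') ≤ 2A·L'³·q_{L'}^{t'} ≤ 2A·(4L)³·(e^{D/L}q_L)^{t'} ≤ 128·A·e^{D}·L³·q_L^{2t}`
  (K2 at `L'`, K1, `t' ≤ L`, `0 ≤ q_L ≤ 1`), and
  `δᶜ(L) ≥ 2x/(1+x)² ≥ x/2 ≥ (a/2)·L^{3/2}·q_L^{t}` (K3 at `L`, `x = x_t(L) ≤ 1` for `L ≥ L₁` uniformly on the window),

hence `δᶜ(L') ≤ (512·A·e^{D}/a²)·δᶜ(L)²` for `L ≥ L₀ := max(L₀¹, L₀², L₀³, L₁, 8)`.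

HONEST FRAMING.  This proves only the implication (the route's `Assembly` item); the three band bounds K1–K3 are the
route's OPEN cruxes, and the conclusion is the strong-coupling RUNG `ColdDoublingRecursionStrongCoupling` of the IR
cell (window `0 ≤ β ≤ strongCouplingRadius ρ`, group-blind) — a RECORD-type ladder rung.  Nothing here bears on weak
coupling, the continuum, or the Yang–Mills mass gap (Clay), which is NOT proved by anything in this file.
-/

set_option autoImplicit false

noncomputable section

open Filter Topology
open Literature.MathematicalPhysics.QuantumFieldTheory
open Literature.MathematicalPhysics.QuantumFieldTheory.Balaban1983to89.Missing (strongCouplingRadius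
  traceExcess_le_of_strongCoupling)
open Summit.QuantumFields.YangMills.Cruxes.IR.ColdPurityBridge (coldDefect one_sub_ratio_le_two_mul_traceExcess
  one_sub_ratio_ge_of_traceExcess ColdDoublingRecursionStrongCoupling)
open Summit.QuantumFields.YangMills.Theorems.DoublingDefect (coldDefect_nonneg)

namespace Summit.QuantumFields.YangMills.Theorems.GlueballBandRecursion

variable {G : Type} [Group G] [TopologicalSpace G] [IsTopologicalGroup G] [CompactSpace G]
  [MeasurableSpace G] [BorelSpace G]

/-- **The thermal trace excess is non-negative**: `0 ≤ x_{m+2}(N)` for `β ≥ 0` and a faithful unitary lattice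
representation — read off the dictionary `0 ≤ δᶜ ≤ 2x` (`coldDefect_nonneg`, `one_sub_ratio_le_two_mul_traceExcess`). -/
theorem traceExcess_nonneg (r : LatticeRep G) {β : ℝ} (hβ : 0 ≤ β) (N m : ℕ) [NeZero N] :
    0 ≤ traceExcess r.ρ β N (m + 2) := by
  haveI : SecondCountableTopology G :=
    (r.continuous.isClosedEmbedding r.injective).isEmbedding.secondCountableTopology
  have h2 := one_sub_ratio_le_two_mul_traceExcess r hβ N m
  have hδ := coldDefect_nonneg r.continuous r.mem_unitary hβ N (m + 2) (by omega)
  linarith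

/-- **The finite-volume rate is non-negative**: `0 ≤ q_N = ⨅ₖ x_{k+2}(N)^{1/(k+2)}` (`β ≥ 0`). -/
theorem rate_nonneg (r : LatticeRep G) {β : ℝ} (hβ : 0 ≤ β) (N : ℕ) [NeZero N] :
    0 ≤ ⨅ k : ℕ, traceExcess r.ρ β N (k + 2) ^ ((1 : ℝ) / ((k : ℝ) + 2)) :=
  Real.iInf_nonneg fun k => Real.rpow_nonneg (traceExcess_nonneg r hβ N k) _

/-- **The rate is dominated by every root of the trace excess**: `q_N ≤ x_{m+2}(N)^{1/(m+2)}` (`β ≥ 0`). -/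
theorem rate_le_rpow (r : LatticeRep G) {β : ℝ} (hβ : 0 ≤ β) (N m : ℕ) [NeZero N] :
    (⨅ k : ℕ, traceExcess r.ρ β N (k + 2) ^ ((1 : ℝ) / ((k : ℝ) + 2))) ≤
      traceExcess r.ρ β N (m + 2) ^ ((1 : ℝ) / ((m : ℝ) + 2)) := by
  have hbdd : BddBelow (Set.range fun k : ℕ => traceExcess r.ρ β N (k + 2) ^ ((1 : ℝ) / ((k : ℝ) + 2))) :=
    ⟨0, by rintro _ ⟨k, rfl⟩; exact Real.rpow_nonneg (traceExcess_nonneg r hβ N k) _⟩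
  exact ciInf_le hbdd m

/-- **Uniform smallness of the cold trace excess on the strong-coupling window**: there is `L₁` with
`x_{⌊L/4⌋}(L) ≤ 1` for every `L ≥ L₁` (`⌊L/4⌋ = m + 2`) and ALL `0 ≤ β ≤ strongCouplingRadius ρ` — from the tree's
`traceExcess_le_of_strongCoupling` (`x_{m+2}(L) ≤ exp(12L³(m+2)e^{−⌊(m+2)/2⌋}) − 1`) and `L⁴e^{−L/8} → 0`. -/
theorem traceExcess_le_one_of_large (r : LatticeRep G) :
    ∃ L₁ : ℕ, ∀ β : ℝ, 0 ≤ β → β ≤ strongCouplingRadius r.ρ →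
      ∀ (L : ℕ) [NeZero L] (m : ℕ), L / 4 = m + 2 → L₁ ≤ L → traceExcess r.ρ β L (m + 2) ≤ 1 := by
  haveI : SecondCountableTopology G :=
    (r.continuous.isClosedEmbedding r.injective).isEmbedding.secondCountableTopology
  have ht : Tendsto (fun u : ℝ => u ^ 4 * Real.exp (-u)) atTop (𝓝 0) :=
    Real.tendsto_pow_mul_exp_neg_atTop_nhds_zero 4
  have hlog2 : 0 < Real.log 2 := Real.log_pos (by norm_num)
  set ε : ℝ := Real.log 2 / (3 * Real.exp 1 * 4096) with hε
  have hεpos : 0 < ε := by positivity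
  obtain ⟨X, hX⟩ := eventually_atTop.1 ((tendsto_order.1 ht).2 ε hεpos)
  refine ⟨⌈8 * X⌉₊, fun β hβ0 hβ L _ m hm hL => ?_⟩
  have hmaj := traceExcess_le_of_strongCoupling r.ρ r.continuous r.mem_unitary hβ0 hβ L m
  have hk : (m + 2) / 2 = L / 8 := by omega
  have h8 : L ≤ 8 * (L / 8) + 7 := by omega
  have h4 : 4 * (m + 2) ≤ L := by omega
  set u : ℝ := (L : ℝ) / 8 with hu
  have huX : X ≤ u := by
    have h1 : (8 * X : ℝ) ≤ ⌈8 * X⌉₊ := Nat.le_ceil _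
    have h2 : (⌈8 * X⌉₊ : ℝ) ≤ L := by exact_mod_cast hL
    rw [hu]; linarith
  have hu4 : u ^ 4 * Real.exp (-u) < ε := hX u huX
  have hkR : -((((m + 2) / 2 : ℕ) : ℝ)) ≤ 1 + -u := by
    rw [hk]
    have : (L : ℝ) ≤ 8 * ((L / 8 : ℕ) : ℝ) + 7 := by exact_mod_cast h8
    rw [hu]; linarith
  have hmR : (m : ℝ) + 2 ≤ 2 * u := by
    have : 4 * ((m : ℝ) + 2) ≤ L := by exact_mod_cast h4
    rw [hu]; linarith
  have hL3 : (L : ℝ) ^ 3 = 512 * u ^ 3 := by rw [hu]; ring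
  have hexp : Real.exp (-((((m + 2) / 2 : ℕ) : ℝ))) ≤ Real.exp 1 * Real.exp (-u) := by
    rw [← Real.exp_add]; exact Real.exp_le_exp.2 hkR
  have hu0 : 0 ≤ u := by positivity
  have hE : 12 * (L : ℝ) ^ 3 * ((m : ℝ) + 2) * Real.exp (-((((m + 2) / 2 : ℕ) : ℝ))) ≤ Real.log 2 := by
    calc 12 * (L : ℝ) ^ 3 * ((m : ℝ) + 2) * Real.exp (-((((m + 2) / 2 : ℕ) : ℝ)))
        ≤ 12 * (512 * u ^ 3) * (2 * u) * (Real.exp 1 * Real.exp (-u)) := by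
          rw [hL3]
          exact mul_le_mul (mul_le_mul_of_nonneg_left hmR (by positivity)) hexp (by positivity) (by positivity)
      _ = 3 * Real.exp 1 * 4096 * (u ^ 4 * Real.exp (-u)) := by ring
      _ ≤ 3 * Real.exp 1 * 4096 * ε := mul_le_mul_of_nonneg_left hu4.le (by positivity)
      _ = Real.log 2 := by rw [hε]; field_simp
  calc traceExcess r.ρ β L (m + 2)
      ≤ Real.exp (12 * (L : ℝ) ^ 3 * ((m : ℝ) + 2) * Real.exp (-((((m + 2) / 2 : ℕ) : ℝ)))) - 1 := hmaj
    _ ≤ Real.exp (Real.log 2) - 1 := by gcongr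
    _ = 1 := by rw [Real.exp_log (by norm_num)]; norm_num

/-- **Assembly of route `GlueballBandRecursion` (stmt-QuantumFields-27509)**:
`GapStableUnderRefinement → ThermalMultiplicityUpper → OneGlueballBandLower → ColdDoublingRecursionStrongCoupling`,
with recursion constant `C = 512·A·e^{D}/a²` and threshold `L₀ = max(L₀¹, L₀², L₀³, L₁, 8)` (`L₁` from
`traceExcess_le_one_of_large`).  Only the implication is proved; K1–K3 stay open; no mass gap is claimed. -/
theorem assembly_proof : Summit.QuantumFields.YangMills.Theses.GlueballBandRecursion.Assembly := by
  intro h₁ h₂ h₃ G _ _ _ _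
  letI : MeasurableSpace G := borel G
  haveI : BorelSpace G := ⟨rfl⟩
  show ∀ r : LatticeRep G, ∃ C : ℝ, 0 < C ∧ ∃ L₀ : ℕ, ∀ β : ℝ, 0 ≤ β → β ≤ strongCouplingRadius r.ρ →
      ∀ L : ℕ, L₀ ≤ L → ∀ L' : ℕ, 2 * L ≤ L' → L' ≤ 4 * L →
        coldDefect r.ρ β L' ≤ C * coldDefect r.ρ β L ^ 2
  intro r
  -- the three band bounds at `(G, r)` and the window smallness
  have hK1' : ∃ D : ℝ, 0 ≤ D ∧ ∃ L₀ : ℕ, ∀ β : ℝ, 0 ≤ β → β ≤ strongCouplingRadius r.ρ →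
      ∀ (L : ℕ) [NeZero L] (L' : ℕ) [NeZero L'], L₀ ≤ L → 2 * L ≤ L' → L' ≤ 4 * L →
        (⨅ k : ℕ, traceExcess r.ρ β L' (k + 2) ^ ((1 : ℝ) / ((k : ℝ) + 2))) ≤
          Real.exp (D / (L : ℝ)) * (⨅ k : ℕ, traceExcess r.ρ β L (k + 2) ^ ((1 : ℝ) / ((k : ℝ) + 2))) :=
    h₁ G r
  have hK2' : ∃ A : ℝ, 0 < A ∧ ∃ L₀ : ℕ, ∀ β : ℝ, 0 ≤ β → β ≤ strongCouplingRadius r.ρ →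
      ∀ (N : ℕ) [NeZero N] (m : ℕ), N / 4 = m + 2 → L₀ ≤ N →
        traceExcess r.ρ β N (m + 2) ≤ A * (N : ℝ) ^ 3 *
          (⨅ k : ℕ, traceExcess r.ρ β N (k + 2) ^ ((1 : ℝ) / ((k : ℝ) + 2))) ^ (m + 2) :=
    h₂ G r
  have hK3' : ∃ a : ℝ, 0 < a ∧ ∃ L₀ : ℕ, ∀ β : ℝ, 0 ≤ β → β ≤ strongCouplingRadius r.ρ →
      ∀ (N : ℕ) [NeZero N] (m : ℕ), N / 4 = m + 2 → L₀ ≤ N →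
        a * Real.sqrt (N : ℝ) ^ 3 *
            (⨅ k : ℕ, traceExcess r.ρ β N (k + 2) ^ ((1 : ℝ) / ((k : ℝ) + 2))) ^ (m + 2) ≤
          traceExcess r.ρ β N (m + 2) :=
    h₃ G r
  obtain ⟨D, hD0, L₁, hK1⟩ := hK1'
  obtain ⟨A, hA0, L₂, hK2⟩ := hK2'
  obtain ⟨a, ha0, L₃, hK3⟩ := hK3'
  obtain ⟨L₄, hK4⟩ := traceExcess_le_one_of_large r
  refine ⟨512 * A * Real.exp D / a ^ 2, by positivity, max (max L₁ L₂) (max (max L₃ L₄) 8), ?_⟩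
  intro β hβ0 hβ L hL L' hLL' hL'L
  have hL₁ : L₁ ≤ L := le_trans (le_trans (le_max_left _ _) (le_max_left _ _)) hL
  have hL₂ : L₂ ≤ L' := by
    have : L₂ ≤ L := le_trans (le_trans (le_max_right _ _) (le_max_left _ _)) hL
    omega
  have hL₃ : L₃ ≤ L := le_trans (le_trans (le_trans (le_max_left _ _) (le_max_left _ _)) (le_max_right _ _)) hL
  have hL₄ : L₄ ≤ L := le_trans (le_trans (le_trans (le_max_right _ _) (le_max_left _ _)) (le_max_right _ _)) hL
  have hL8 : 8 ≤ L := le_trans (le_trans (le_max_right _ _) (le_max_right _ _)) hL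
  haveI : NeZero L := ⟨by omega⟩
  haveI : NeZero L' := ⟨by omega⟩
  obtain ⟨m, hm⟩ : ∃ m : ℕ, L / 4 = m + 2 := ⟨L / 4 - 2, by omega⟩
  obtain ⟨m', hm'⟩ : ∃ m' : ℕ, L' / 4 = m' + 2 := ⟨L' / 4 - 2, by omega⟩
  have htt : 2 * (m + 2) ≤ m' + 2 := by omega
  have ht'L : m' + 2 ≤ L := by omega
  -- abbreviations
  set qL : ℝ := ⨅ k : ℕ, traceExcess r.ρ β L (k + 2) ^ ((1 : ℝ) / ((k : ℝ) + 2)) with hqLdef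
  set qL' : ℝ := ⨅ k : ℕ, traceExcess r.ρ β L' (k + 2) ^ ((1 : ℝ) / ((k : ℝ) + 2)) with hqL'def
  set x : ℝ := traceExcess r.ρ β L (m + 2) with hxdef
  set x' : ℝ := traceExcess r.ρ β L' (m' + 2) with hx'def
  set δ : ℝ := coldDefect r.ρ β L with hδdef
  set δ' : ℝ := coldDefect r.ρ β L' with hδ'def
  -- basic ranges
  have hx0 : 0 ≤ x := traceExcess_nonneg r hβ0 L m
  have hx1 : x ≤ 1 := hK4 β hβ0 hβ L m hm hL₄
  have hqL0 : 0 ≤ qL := rate_nonneg r hβ0 L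
  have hqL'0 : 0 ≤ qL' := rate_nonneg r hβ0 L'
  have hqL1 : qL ≤ 1 :=
    (rate_le_rpow r hβ0 L m).trans (Real.rpow_le_one hx0 hx1 (by positivity))
  -- the three band bounds, instantiated
  have h1 : qL' ≤ Real.exp (D / (L : ℝ)) * qL := hK1 β hβ0 hβ L L' hL₁ hLL' hL'L
  have h2 : x' ≤ A * (L' : ℝ) ^ 3 * qL' ^ (m' + 2) := hK2 β hβ0 hβ L' m' hm' hL₂
  have h3 : a * Real.sqrt (L : ℝ) ^ 3 * qL ^ (m + 2) ≤ x := hK3 β hβ0 hβ L m hm hL₃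
  -- the dictionary
  have hup : δ' ≤ 2 * x' := by
    have h := one_sub_ratio_le_two_mul_traceExcess r hβ0 L' m'
    rw [hδ'def]; unfold coldDefect; rw [hm']; exact h
  have hlow : 2 * x / (1 + x) ^ 2 ≤ δ := by
    have h := one_sub_ratio_ge_of_traceExcess r hβ0 L m
    rw [hδdef]; unfold coldDefect; rw [hm]; exact h
  have hxδ : x ≤ 2 * δ := by
    have h1x : (0 : ℝ) < (1 + x) ^ 2 := by positivity
    have hsq : (1 + x) ^ 2 ≤ 4 := by nlinarith
    have : x / 2 ≤ 2 * x / (1 + x) ^ 2 := by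
      rw [le_div_iff₀ h1x]
      have : x / 2 * (1 + x) ^ 2 ≤ x / 2 * 4 := mul_le_mul_of_nonneg_left hsq (by positivity)
      linarith
    linarith
  have hδ0 : 0 ≤ δ := by linarith
  -- powers of the rate
  set y : ℝ := qL ^ (m + 2) with hydef
  have hy0 : 0 ≤ y := pow_nonneg hqL0 _
  have hexpD : Real.exp (D / (L : ℝ)) ^ (m' + 2) ≤ Real.exp D := by
    rw [← Real.exp_nat_mul]
    refine Real.exp_le_exp.2 ?_
    have hLpos : (0 : ℝ) < L := by exact_mod_cast (show 0 < L by omega)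
    have ht' : ((m' + 2 : ℕ) : ℝ) ≤ L := by exact_mod_cast ht'L
    rw [div_eq_mul_inv, show ((m' + 2 : ℕ) : ℝ) * (D * (L : ℝ)⁻¹) = D * (((m' + 2 : ℕ) : ℝ) / L) by ring]
    have hfrac : ((m' + 2 : ℕ) : ℝ) / L ≤ 1 := by rw [div_le_one hLpos]; exact ht'
    nlinarith
  have hpow : qL' ^ (m' + 2) ≤ Real.exp D * y ^ 2 := by
    calc qL' ^ (m' + 2) ≤ (Real.exp (D / (L : ℝ)) * qL) ^ (m' + 2) := pow_le_pow_left₀ hqL'0 h1 _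
      _ = Real.exp (D / (L : ℝ)) ^ (m' + 2) * qL ^ (m' + 2) := mul_pow _ _ _
      _ ≤ Real.exp D * qL ^ (2 * (m + 2)) :=
          mul_le_mul hexpD (pow_le_pow_of_le_one hqL0 hqL1 htt) (pow_nonneg hqL0 _) (by positivity)
      _ = Real.exp D * y ^ 2 := by rw [hydef, ← pow_mul, mul_comm (m + 2) 2]
  -- upper side: `δ' ≤ 128·A·e^D·(L³·y²)`
  have hL'R : (L' : ℝ) ≤ 4 * L := by exact_mod_cast hL'L
  have hL'3 : (L' : ℝ) ^ 3 ≤ 64 * (L : ℝ) ^ 3 := by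
    calc (L' : ℝ) ^ 3 ≤ (4 * (L : ℝ)) ^ 3 := pow_le_pow_left₀ (by positivity) hL'R 3
      _ = 64 * (L : ℝ) ^ 3 := by ring
  have hupper : δ' ≤ 128 * A * Real.exp D * ((L : ℝ) ^ 3 * y ^ 2) := by
    calc δ' ≤ 2 * x' := hup
      _ ≤ 2 * (A * (L' : ℝ) ^ 3 * qL' ^ (m' + 2)) := by linarith
      _ ≤ 2 * (A * (64 * (L : ℝ) ^ 3) * (Real.exp D * y ^ 2)) := by
          gcongr
      _ = 128 * A * Real.exp D * ((L : ℝ) ^ 3 * y ^ 2) := by ring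
  -- lower side: `a²·L³·y² ≤ 4δ²`
  have hs : Real.sqrt (L : ℝ) ^ 2 = L := Real.sq_sqrt (by positivity)
  have hs3 : (Real.sqrt (L : ℝ) ^ 3) ^ 2 = (L : ℝ) ^ 3 := by
    calc (Real.sqrt (L : ℝ) ^ 3) ^ 2 = (Real.sqrt (L : ℝ) ^ 2) ^ 3 := by ring
      _ = (L : ℝ) ^ 3 := by rw [hs]
  have hay : a * Real.sqrt (L : ℝ) ^ 3 * y ≤ 2 * δ := h3.trans hxδ
  have hay0 : 0 ≤ a * Real.sqrt (L : ℝ) ^ 3 * y := by positivity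
  have hkey : a ^ 2 * ((L : ℝ) ^ 3 * y ^ 2) ≤ 4 * δ ^ 2 := by
    have hsqle : (a * Real.sqrt (L : ℝ) ^ 3 * y) ^ 2 ≤ (2 * δ) ^ 2 := pow_le_pow_left₀ hay0 hay 2
    calc a ^ 2 * ((L : ℝ) ^ 3 * y ^ 2) = (a * Real.sqrt (L : ℝ) ^ 3 * y) ^ 2 := by rw [← hs3]; ring
      _ ≤ (2 * δ) ^ 2 := hsqle
      _ = 4 * δ ^ 2 := by ring
  -- conclusion
  have ha2 : (0 : ℝ) < a ^ 2 := by positivity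
  calc δ' ≤ 128 * A * Real.exp D * ((L : ℝ) ^ 3 * y ^ 2) := hupper
    _ = (128 * A * Real.exp D / a ^ 2) * (a ^ 2 * ((L : ℝ) ^ 3 * y ^ 2)) := by
        field_simp
    _ ≤ (128 * A * Real.exp D / a ^ 2) * (4 * δ ^ 2) := mul_le_mul_of_nonneg_left hkey (by positivity)
    _ = 512 * A * Real.exp D / a ^ 2 * δ ^ 2 := by ring

end Summit.QuantumFields.YangMills.Theorems.GlueballBandRecursion

end
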